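import Summits.BirchSwinnertonDyer.BirchSwinnertonDyer.Theses.CongruentShaFreeCut
import Summits.BirchSwinnertonDyer.BirchSwinnertonDyer.Theorems.CongruentShaFreeCutHeegnerFieldData
import Summits.BirchSwinnertonDyer.BirchSwinnertonDyer.Theorems.CongruentShaFreeCutSquarefreeReduction
import Literature.NumberTheory.EllipticCurves.BSDHeegnerPoints
import Literature.NumberTheory.EllipticCurves.BSDAnalyticRankTunnellCMProofs

/-! # Route `CongruentShaFreeCut` (rung S2) — crux `AnalyticRankOneOfRankOneFiniteShaTwo`
(stmt-BirchSwinnertonDyer-19080) modulo ONE named Heegner-point statement (the alternative cut v2)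

The alternative BC3 cut of crux B (plan g9,
`HOME/bsd-cn100-plan/routes-g9/bc/AnalyticRankOneOfRankOneFiniteShaTwo_birth_v2.lean`, line
`heegner-field-gz`) states the research stub at `ℚ`-level and Heegner-point-shaped:
`stub_heegnerNonTorsion` — for square-free `n`, an auxiliary imaginary quadratic `K` with the
Heegner hypothesis for `N = N(E_n)`, `2` split in `K` and `L(E_n^{(d_K)}, 1) ≠ 0`, the crux's own
hypotheses `rank E_n(ℚ) = 1 ∧ #Ш(E_n/ℚ)[2^∞] < ∞` force every Heegner point of level `N` in
`E_n(K)` to have infinite order: the object every rank-one `p`-converse proof in print actually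
produces (Fan–Wan arXiv:2304.09806v2 Thm. 6.9 «virtual Heegner point non-torsion from corank one»,
unrefereed; BKO 2024 Thm. 1.5's last step via Perrin-Riou; Burungale–Tian / BCST via BDP). This file
NAMES that stub (`HeegnerNonTorsionAtTwo`, token-identical, nothing asserted) and lands the v2
composition as a HELPER THEOREM with the three S-size companions discharged:
`stub_heegnerFieldSupply` by the landed
`CongruentShaFreeCutHeegnerFieldData.heegnerFieldData_full_of_parity_of_hoffsteinLuo_of_kato`
(refereed facts `p_parity`, Modularity, Hoffstein–Luo, Kato), `stub_grossZagierCloser` by the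
refereed named facts `exists_isHeegnerPoint` (Gross 1984 / Gross–Zagier I.§4) and
`analyticRankEK_eq_one_iff_heegner_nonTorsion` (Gross–Zagier 1986 Thm. I.6.3) on the globally
minimal model (`isGloballyMinimal_congruentNumberCurve`, square-free `n`), and
`stub_squarefreeReduction` by the tree theorem
`CongruentShaFreeCutSquarefreeReduction.analyticRankOneOfRankOneFiniteShaTwo_of_squarefree`.
Conversely `heegnerNonTorsionAtTwo_of_cruxB`: the stub follows from crux B modulo Modularity and
Gross–Zagier, so `HeegnerNonTorsionAtTwo ↔ crux B` modulo refereed facts (the v2 cut is faithful).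
Supports, does not close, stmt-BirchSwinnertonDyer-19080. -/

noncomputable section

open scoped Classical

namespace Summit.BirchSwinnertonDyer.BirchSwinnertonDyer.Theorems.CongruentShaFreeCutOfHeegnerNonTorsion

open Literature.NumberTheory.EllipticCurves WeierstrassCurve
open Summit.BirchSwinnertonDyer.BirchSwinnertonDyer.Theses.CongruentShaFreeCut

/-- **`HeegnerNonTorsionAtTwo` — Heegner points of `E_n` over an auxiliary field are non-torsion
when `rank E_n(ℚ) = 1` and `Ш(E_n/ℚ)[2^∞]` is finite** (= `stub_heegnerNonTorsion` of the BC3 cut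
v2 of crux `AnalyticRankOneOfRankOneFiniteShaTwo`, token for token; OPEN, research-grade — Fan–Wan
v2 Thm. 6.9-shaped; nothing asserted). For square-free `n`, an imaginary quadratic `K` satisfying
the Heegner hypothesis for `N = N(E_n)` with `2` split in `K` and `L(E_n^{(d_K)}, 1) ≠ 0`: if
`rank E_n(ℚ) = 1` and `Ш(E_n/ℚ)[2^∞]` is finite then every Heegner point of level `N` in `E_n(K)`
has infinite order. Intended mechanism: corank one ⟹ a `2`-adic anticyclotomic main-conjecture
lower bound with control at the ADDITIVE prime `2` ⟹ the `2`-adic Waldspurger/BDP-type value at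
the trivial character is non-zero ⟹ (explicit reciprocity law) the Heegner class has non-zero
`2`-adic logarithm (Fan–Wan arXiv:2304.09806v2 Thm. 4.2/4.4, 5.18, 6.9 — unrefereed; refereed
models: BKO 2024 Thm. 1.5 (`p ≥ 5` inert), Burungale–Tian 2020 (split ordinary `p > 3`), BCST
2022 (good ordinary)). Implies crux B modulo refereed facts
(`analyticRankOne_of_facts_of_heegnerNonTorsion`). -/
@[conjecture] def HeegnerNonTorsionAtTwo : Prop :=
  ∀ ⦃n : ℕ⦄, Squarefree n → ∀ (K : Type) [Field K] [NumberField K] (N : ℕ) [NeZero N],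
    (congruentNumberCurve n).conductorNorm ℤ = N → IsImaginaryQuadratic K →
      SatisfiesHeegnerHypothesis N K → SatisfiesHeegnerHypothesis 2 K →
        ((congruentNumberCurve n).quadraticTwist (NumberField.discr K : ℚ)).entireLFunction 1 ≠ 0 →
          (congruentNumberCurve n).mordellWeilRank = 1 →
            Finite (AddCommGroup.primaryComponent (congruentNumberCurve n).sha 2) →
              ∀ (P : ((congruentNumberCurve n).baseChange K).toAffine.Point),
                IsHeegnerPoint N (congruentNumberCurve n) K P → ¬ IsOfFinAddOrder P

/-- **Crux B modulo `HeegnerNonTorsionAtTwo` and six refereed facts** (the v2 composition as a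
helper theorem). Granted `2`-parity (`hpar`), Modularity (`hmod`), Hoffstein–Luo (`hHL`), Kato
(`hKato`), the existence of Heegner points over fields with the Heegner hypothesis (`hHP`, Gross
1984) and Gross–Zagier's `ord_{s=1} L(E/K, s) = 1 ↔ y_K` non-torsion (`hGZ`, Gross–Zagier 1986
Thm. I.6.3 with Kolyvagin for the height), `HeegnerNonTorsionAtTwo` (`hNT`) gives, for every
`n ≠ 0`: `rank E_n(ℚ) = 1 ∧ #Ш(E_n/ℚ)[2^∞] < ∞ ⟹ ord_{s=1} L(E_n, s) = 1`. Proof: reduce to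
square-free `n` (`analyticRankOneOfRankOneFiniteShaTwo_of_squarefree`); take the auxiliary `K` of
`heegnerFieldData_full_of_parity_of_hoffsteinLuo_of_kato` (Heegner hypothesis for `N(E_n)` and `2`,
`L(E_n^{(d_K)}, 1) ≠ 0`, `ord L(E_n/K) = ord L(E_n)`); a Heegner point `P ∈ E_n(K)` of level
`N(E_n)` exists (`hHP`, on the globally minimal model `isGloballyMinimal_congruentNumberCurve`);
`hNT` makes it non-torsion; `hGZ` turns that into `ord_{s=1} L(E_n/K, s) = 1`.
[cite: GrossZagier1986, Thm. I.6.3 with V.§2] [cite: Gross1984, §§3–4] -/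
theorem analyticRankOne_of_facts_of_heegnerNonTorsion
    (hpar : ∀ (W : WeierstrassCurve ℚ) [W.IsElliptic] (p : ℕ) [Fact p.Prime], p_parity W p)
    (hmod : ModularForms.exists_isNewformOf) (hHL : HoffsteinLuo1997_exists_twist_L_one_ne_zero)
    (hKato : ∀ (W : WeierstrassCurve ℚ) [W.IsElliptic] (p : ℕ) [Fact p.Prime],
      kato_finite_of_L_one_ne_zero W p)
    (hHP : ∀ (W : WeierstrassCurve ℚ) (K : Type) [Field K] [NumberField K],
      exists_isHeegnerPoint W K)
    (hGZ : ∀ (W : WeierstrassCurve ℚ) (N : ℕ) [NeZero N] (K : Type) [Field K] [NumberField K],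
      analyticRankEK_eq_one_iff_heegner_nonTorsion W N K)
    (hNT : HeegnerNonTorsionAtTwo) :
    AnalyticRankOneOfRankOneFiniteShaTwo := by
  refine CongruentShaFreeCutSquarefreeReduction.analyticRankOneOfRankOneFiniteShaTwo_of_squarefree
    fun m hm hrm hfinm => ?_
  haveI := isElliptic_congruentNumberCurve hm.ne_zero
  haveI := isGloballyMinimal_congruentNumberCurve hm
  haveI : NeZero ((congruentNumberCurve m).conductorNorm ℤ) :=
    ⟨((congruentNumberCurve m).conductorNorm_pos_holds).ne'⟩
  obtain ⟨K, _, _, hK, -, hHN, hH2, -, hL, -, -, hfac⟩ :=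
    CongruentShaFreeCutHeegnerFieldData.heegnerFieldData_full_of_parity_of_hoffsteinLuo_of_kato hpar
      hmod hHL hKato hm.ne_zero hrm hfinm 0
  have hNT' := hNT hm K ((congruentNumberCurve m).conductorNorm ℤ) rfl hK hHN hH2 hL hrm hfinm
  obtain ⟨P, hP⟩ := hHP (congruentNumberCurve m) K hK hHN
  have h1 : analyticRankEK (congruentNumberCurve m) K = 1 :=
    (hGZ (congruentNumberCurve m) _ K hK rfl hHN hP).mpr (hNT' P hP)
  rwa [hfac] at h1

/-- **`HeegnerNonTorsionAtTwo` from crux B, modulo Modularity and Gross–Zagier** (the v2 cut is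
faithful: its research stub ≡ crux B modulo refereed facts, like the `K`-level stub of the cut of
record, `CongruentShaFreeCutOfTwoConverseOverK.twoConverseOverK_of_cruxB_of_burungaleTian`). Given the
stub's data — square-free `n`, `K` with the Heegner hypothesis for `N = N(E_n)`,
`L(E_n^{(d_K)}, 1) ≠ 0`, `rank E_n(ℚ) = 1`, `Ш(E_n/ℚ)[2^∞]` finite, a Heegner point `P` of level `N` —
crux B (`hB`) gives `ord_{s=1} L(E_n, s) = 1`, the twist has analytic rank `0`
(`analyticRank_eq_zero_of_entireLFunction_one_ne_zero`), Artin formalism (`analyticRankEK_eq_add_of`,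
from Modularity `hmod`) gives `ord_{s=1} L(E_n/K, s) = 1`, and Gross–Zagier (`hGZ`,
`analyticRankEK_eq_one_iff_heegner_nonTorsion`) makes `P` non-torsion. The Heegner hypothesis at `2`
is not used. [cite: GrossZagier1986, Thm. I.6.3 with V.§2 and I.§7] -/
theorem heegnerNonTorsionAtTwo_of_cruxB (hmod : ModularForms.exists_isNewformOf)
    (hGZ : ∀ (W : WeierstrassCurve ℚ) (N : ℕ) [NeZero N] (K : Type) [Field K] [NumberField K],
      analyticRankEK_eq_one_iff_heegner_nonTorsion W N K)
    (hB : AnalyticRankOneOfRankOneFiniteShaTwo) : HeegnerNonTorsionAtTwo := by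
  intro n hsq K _ _ N _ hN hK hHN _ hL hrank hsha P hP
  haveI := isElliptic_congruentNumberCurve hsq.ne_zero
  haveI := isGloballyMinimal_congruentNumberCurve hsq
  have h1 : (congruentNumberCurve n).analyticRank = 1 := hB hsq.ne_zero hrank hsha
  have hd : (NumberField.discr K : ℚ) ≠ 0 := by exact_mod_cast NumberField.discr_ne_zero K
  haveI := (congruentNumberCurve n).isElliptic_quadraticTwist hd
  have h0 : ((congruentNumberCurve n).quadraticTwist (NumberField.discr K : ℚ)).analyticRank = 0 :=
    analyticRank_eq_zero_of_entireLFunction_one_ne_zero _ hL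
  have hEK : analyticRankEK (congruentNumberCurve n) K = 1 := by
    rw [analyticRankEK_eq_add_of (hasEntireLFunction_rat_of_exists_isNewformOf hmod)
      (congruentNumberCurve n) K, h1, h0]
  exact (hGZ (congruentNumberCurve n) N K hK hN hHN hP).mp hEK

end Summit.BirchSwinnertonDyer.BirchSwinnertonDyer.Theorems.CongruentShaFreeCutOfHeegnerNonTorsion

end
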